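import Summits.CriticalPhenomena.PercolationContinuityZ3.Theorems.PercAnnulusCrossingIICAspectKernelCrossRatio
import Summits.CriticalPhenomena.PercolationContinuityZ3.Theorems.PercAnnulusCrossingIICAspectLevelTwoSided
import Summits.CriticalPhenomena.PercolationContinuityZ3.Theorems.PercAnnulusCrossingIICSchemeLevel
import HarnessLib

/-!
# Kesten–Basu–Sapozhnikov IIC scheme in boxes at a GENERAL ASPECT, XIII′: one level of Kesten's scheme (lane RSW3, p1 gen 4)

builds on p205010 (kernel theorem, internal audit signed; external expert review pending)

Seat `prim-rsw3-p1` (gen 4).  General-aspect companion of part XIII (`PercAnnulusCrossingIICSchemeLevel.lean`): (A2)□ with an abstract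
middle-sphere map `σ` and outer-radius map `τ` (`m < σ m < τ m` for `m ≥ 1`, both monotone; `σ = (s·)`, `τ = (L·)` is
`Crossing.SetToSetQuasiMultAspectAt d p s L ϰ`).  One level: outer annulus `(σ M₁, σ M₂)` with data `D = (U,R)`, inward shell
`(c,s) = (σ μ₁ − 1, σ μ₂)` (`μ₂ ≤ M₁`), inner data `C = (H,X)`, `H ⊆ Λ(μ₁−1)`, `X ⊆ Λ(μ₁)`.  Helper file; no definitions, no sorries;
every `p`, `d`.  Proofs = part XIII verbatim with `2m ↦ σ m`, `4m ↦ τ m`.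
* **`sum_kernel_mul_conn_two_sided_aspect`** — Kesten's eq. (22) with junk:
  `(1 − ϰ⁻²(α(σ μ₁, σ μ₂) + α(σ M₁, σ M₂))) · γ_n(C) ≤ Σ_D M(C;D) γ_n(D) ≤ γ_n(C)`;
* `mul_le_kernel_and_kernel_le_mul_aspect` — `ϰ · a(C) · β(D) ≤ M(C;D) ≤ a(C) · β(D)` (`a(C) = P(X ↔ ∂ⁱⁿΛ(σ m) in Λ(σ m) ∖ H)`, `τ m + 2 ≤ σ μ₁`).
References: H. Kesten, PTRF 73 (1986) §2 eq. (22), Lemma (23); D. Basu, A. Sapozhnikov, ECP 22 (2017) no. 26, §2.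
-/

noncomputable section

namespace Summit.CriticalPhenomena.PercolationContinuityZ3.Theorems.Crossing

open MeasureTheory Literature.Probability.Percolation Literature.Probability.LatticeModels
open Literature.Probability.Percolation.DCT16
open Summit.CriticalPhenomena.PercolationContinuityZ3.Theorems.SurfaceTension
open scoped Literature.Probability.Percolation

variable {d : ℕ}

/-- **One level of Kesten's scheme at a general aspect, two-sided** (eq. (22) with junk): see the module docstring.
[cite: Kesten1986, §2 eq. (22)] [cite: BasuSapozhnikov2017ECP, §2 (2.5)–(2.7)] -/
theorem sum_kernel_mul_conn_two_sided_aspect (p : unitInterval) {ϰ : ℝ} (hϰ : 0 < ϰ)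
    {σ τ : ℕ → ℕ} (hσ : ∀ m : ℕ, 1 ≤ m → m < σ m) (hστ : ∀ m : ℕ, 1 ≤ m → σ m < τ m)
    (hσm : Monotone σ) (hτm : Monotone τ)
    (hA2 : ∀ m : ℕ, 1 ≤ m → ∀ Z : Finset (Site d), box d (τ m) \ box d (m - 1) ⊆ Z →
      ∀ X : Finset (Site d), X ⊆ Z ∩ box d m → ∀ Y : Finset (Site d), Y ⊆ Z \ box d (τ m) →
        ϰ * (bondPercolation (zdGraph d) p).real {ω | ∃ x ∈ X, ∃ s ∈ innerBoundary (zdGraph d) (box d (σ m)),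
              ω ∈ openConnIn (↑Z : Set (Site d)) x s} *
          (bondPercolation (zdGraph d) p).real {ω | ∃ y ∈ Y, ∃ s ∈ innerBoundary (zdGraph d) (box d (σ m)),
              ω ∈ openConnIn (↑Z : Set (Site d)) y s} ≤
        (bondPercolation (zdGraph d) p).real {ω | ∃ x ∈ X, ∃ y ∈ Y, ω ∈ openConnIn (↑Z : Set (Site d)) x y})
    {μ₁ μ₂ M₁ M₂ n : ℕ} (hμ₁ : 1 ≤ μ₁) (hμ12 : τ μ₁ < σ μ₂) (hμM : μ₂ ≤ M₁) (hM12 : τ M₁ < σ M₂) (hn : τ M₂ < n)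
    {H X : Finset (Site d)} (hH : H ⊆ box d (μ₁ - 1)) (hX : X ⊆ box d μ₁) (hXH : ∀ x ∈ X, x ∉ H) :
    (1 - ϰ⁻¹ ^ 2 * ((bondPercolation (zdGraph d) p).real (boxCrossing d (σ μ₁) (σ μ₂)) +
        (bondPercolation (zdGraph d) p).real (boxCrossing d (σ M₁) (σ M₂)))) *
        (bondPercolation (zdGraph d) p).real {ω : BondConfig (Site d) | ∃ x ∈ X, ∃ t ∈ innerBoundary (zdGraph d) (box d n),
            ω ∈ openConnIn ((↑(box d n) : Set (Site d)) \ ↑H) x t} ≤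
      ∑ D ∈ ((box d (σ M₂)).powerset.filter (fun U => box d (σ M₁) ⊆ U)) ×ˢ (box d (σ M₂ + 1)).powerset,
        (bondPercolation (zdGraph d) p).real
        ((⋃ I ∈ (box d (σ μ₂ - 1) \ box d (σ μ₁ - 1)).powerset ×ˢ (innerBoundary (zdGraph d) (box d (σ μ₁ - 1))).powerset,
            ({ω : BondConfig (Site d) | ω ∩ (↑((box d (σ μ₂)).sym2) : Set (Sym2 (Site d))) ∈
                explEvent ((↑(box d (σ μ₂ - 1)) : Set (Site d))ᶜ) ((↑(box d (σ μ₂ - 1)) : Set (Site d)) \ ↑(box d (σ μ₁ - 1)))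
                  ((↑(box d (σ μ₂ - 1)) : Set (Site d))ᶜ ∪ ↑I.1) ↑I.2} ∩
             {ω : BondConfig (Site d) | ∀ y ∈ I.2, ∀ y' ∈ I.2, ∀ z ∈ I.1 ∪ innerBoundary (zdGraph d) (box d (σ μ₂)),
                ∀ z' ∈ I.1 ∪ innerBoundary (zdGraph d) (box d (σ μ₂)), s(z, y) ∈ ω → s(z', y') ∈ ω →
                ω ∈ openConnIn (↑(I.1 ∪ innerBoundary (zdGraph d) (box d (σ μ₂))) : Set (Site d)) z z'})) ∩
          ({ω : BondConfig (Site d) | ∃ x ∈ X, ∃ r ∈ D.2, ∃ v ∈ D.1, ω ∈ openConnIn ((↑D.1 : Set (Site d)) \ ↑H) x v ∧ s(v, r) ∈ ω} ∩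
           {ω : BondConfig (Site d) | ω ∩ (↑((box d (σ M₂ + 1)).sym2) : Set (Sym2 (Site d))) ∈
            explEvent (↑(box d (σ M₁)) : Set (Site d)) ((↑(box d (σ M₂)) : Set (Site d)) \ ↑(box d (σ M₁))) ↑D.1 ↑D.2} ∩
           {ω : BondConfig (Site d) | ∀ r ∈ D.2, ∀ r' ∈ D.2, ∃ v ∈ D.1, ∃ v' ∈ D.1,
            s(v, r) ∈ ω ∧ s(v', r') ∈ ω ∧ ω ∈ openConnIn ((↑D.1 : Set (Site d)) \ ↑(box d (σ M₁ - 1))) v v'})) *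
        (bondPercolation (zdGraph d) p).real {ω : BondConfig (Site d) | ∃ x ∈ D.2, ∃ t ∈ innerBoundary (zdGraph d) (box d n),
            ω ∈ openConnIn ((↑(box d n) : Set (Site d)) \ ↑D.1) x t} ∧
    ∑ D ∈ ((box d (σ M₂)).powerset.filter (fun U => box d (σ M₁) ⊆ U)) ×ˢ (box d (σ M₂ + 1)).powerset,
        (bondPercolation (zdGraph d) p).real
        ((⋃ I ∈ (box d (σ μ₂ - 1) \ box d (σ μ₁ - 1)).powerset ×ˢ (innerBoundary (zdGraph d) (box d (σ μ₁ - 1))).powerset,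
            ({ω : BondConfig (Site d) | ω ∩ (↑((box d (σ μ₂)).sym2) : Set (Sym2 (Site d))) ∈
                explEvent ((↑(box d (σ μ₂ - 1)) : Set (Site d))ᶜ) ((↑(box d (σ μ₂ - 1)) : Set (Site d)) \ ↑(box d (σ μ₁ - 1)))
                  ((↑(box d (σ μ₂ - 1)) : Set (Site d))ᶜ ∪ ↑I.1) ↑I.2} ∩
             {ω : BondConfig (Site d) | ∀ y ∈ I.2, ∀ y' ∈ I.2, ∀ z ∈ I.1 ∪ innerBoundary (zdGraph d) (box d (σ μ₂)),
                ∀ z' ∈ I.1 ∪ innerBoundary (zdGraph d) (box d (σ μ₂)), s(z, y) ∈ ω → s(z', y') ∈ ω →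
                ω ∈ openConnIn (↑(I.1 ∪ innerBoundary (zdGraph d) (box d (σ μ₂))) : Set (Site d)) z z'})) ∩
          ({ω : BondConfig (Site d) | ∃ x ∈ X, ∃ r ∈ D.2, ∃ v ∈ D.1, ω ∈ openConnIn ((↑D.1 : Set (Site d)) \ ↑H) x v ∧ s(v, r) ∈ ω} ∩
           {ω : BondConfig (Site d) | ω ∩ (↑((box d (σ M₂ + 1)).sym2) : Set (Sym2 (Site d))) ∈
            explEvent (↑(box d (σ M₁)) : Set (Site d)) ((↑(box d (σ M₂)) : Set (Site d)) \ ↑(box d (σ M₁))) ↑D.1 ↑D.2} ∩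
           {ω : BondConfig (Site d) | ∀ r ∈ D.2, ∀ r' ∈ D.2, ∃ v ∈ D.1, ∃ v' ∈ D.1,
            s(v, r) ∈ ω ∧ s(v', r') ∈ ω ∧ ω ∈ openConnIn ((↑D.1 : Set (Site d)) \ ↑(box d (σ M₁ - 1))) v v'})) *
        (bondPercolation (zdGraph d) p).real {ω : BondConfig (Site d) | ∃ x ∈ D.2, ∃ t ∈ innerBoundary (zdGraph d) (box d n),
            ω ∈ openConnIn ((↑(box d n) : Set (Site d)) \ ↑D.1) x t} ≤
      (bondPercolation (zdGraph d) p).real {ω : BondConfig (Site d) | ∃ x ∈ X, ∃ t ∈ innerBoundary (zdGraph d) (box d n),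
            ω ∈ openConnIn ((↑(box d n) : Set (Site d)) \ ↑H) x t} := by
  classical
  have hσ1 := hσ μ₁ hμ₁
  have hστ1 := hστ μ₁ hμ₁
  have hμ12' : μ₁ < μ₂ := hσm.reflect_lt (by omega)
  have hσ2 := hσ μ₂ (by omega)
  have hστ2 := hστ μ₂ (by omega)
  have hσμM : σ μ₂ ≤ σ M₁ := hσm hμM
  have hτμM : τ μ₂ ≤ τ M₁ := hτm hμM
  have hσM1 := hσ M₁ (by omega)
  have hστM1 := hστ M₁ (by omega)
  have hM12' : M₁ < M₂ := hσm.reflect_lt (by omega)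
  have hσM2 := hσ M₂ (by omega)
  have hστM2 := hστ M₂ (by omega)
  set μ := bondPercolation (zdGraph d) p with hμ
  set G := (⋃ I ∈ (box d (σ μ₂ - 1) \ box d (σ μ₁ - 1)).powerset ×ˢ (innerBoundary (zdGraph d) (box d (σ μ₁ - 1))).powerset,
            ({ω : BondConfig (Site d) | ω ∩ (↑((box d (σ μ₂)).sym2) : Set (Sym2 (Site d))) ∈
                explEvent ((↑(box d (σ μ₂ - 1)) : Set (Site d))ᶜ) ((↑(box d (σ μ₂ - 1)) : Set (Site d)) \ ↑(box d (σ μ₁ - 1)))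
                  ((↑(box d (σ μ₂ - 1)) : Set (Site d))ᶜ ∪ ↑I.1) ↑I.2} ∩
             {ω : BondConfig (Site d) | ∀ y ∈ I.2, ∀ y' ∈ I.2, ∀ z ∈ I.1 ∪ innerBoundary (zdGraph d) (box d (σ μ₂)),
                ∀ z' ∈ I.1 ∪ innerBoundary (zdGraph d) (box d (σ μ₂)), s(z, y) ∈ ω → s(z', y') ∈ ω →
                ω ∈ openConnIn (↑(I.1 ∪ innerBoundary (zdGraph d) (box d (σ μ₂))) : Set (Site d)) z z'})) with hG
  set CO := {ω : BondConfig (Site d) | ∃ x ∈ X, ∃ t ∈ innerBoundary (zdGraph d) (box d n),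
            ω ∈ openConnIn ((↑(box d n) : Set (Site d)) \ ↑H) x t} with hCO
  -- `GOOD_in` is determined by the pairs of `Λ(s)`
  have hGdet : DeterminedBy G (↑((box d (σ μ₂)).sym2) : Set (Sym2 (Site d))) := by
    refine DeterminedBy.iUnion fun I => DeterminedBy.iUnion fun hI => ?_
    rw [Finset.mem_product, Finset.mem_powerset, Finset.mem_powerset] at hI
    have hT : {e : Sym2 (Site d) | e ∈ (↑((box d (σ μ₂)).sym2) : Set (Sym2 (Site d))) ∧
        ∃ v ∈ (↑(I.1 ∪ innerBoundary (zdGraph d) (box d (σ μ₂))) : Set (Site d)), v ∈ e} ⊆ ↑((box d (σ μ₂)).sym2) :=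
      fun e he => he.1
    exact ((determinedBy_idat (c := σ μ₁ - 1) (by omega : 1 ≤ σ μ₂) I.1 I.2).mono hT).inter
      ((determinedBy_ilink (by omega : σ μ₁ - 1 ≤ σ μ₂) hI.1 hI.2).mono hT)
  have hF : (box d (σ μ₂)).sym2 ⊆ (box d (σ M₁)).sym2 := Finset.sym2_mono (box_mono d hσμM)
  have h2 := sum_real_level_two_sided_aspect p hϰ hσ hστ hA2 (m₁ := M₁) (m₂ := M₂) (n := n) (by omega) hM12'.le hM12 hn
    (hH.trans (box_mono d (by omega))) (hX.trans (box_mono d (by omega))) hXH hGdet hF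
  -- reorder the intersections in the summands
  have hsum : ∀ D : Finset (Site d) × Finset (Site d),
      G ∩ {ω : BondConfig (Site d) | ω ∩ (↑((box d (σ M₂ + 1)).sym2) : Set (Sym2 (Site d))) ∈
            explEvent (↑(box d (σ M₁)) : Set (Site d)) ((↑(box d (σ M₂)) : Set (Site d)) \ ↑(box d (σ M₁))) ↑D.1 ↑D.2} ∩
        {ω : BondConfig (Site d) | ∀ r ∈ D.2, ∀ r' ∈ D.2, ∃ v ∈ D.1, ∃ v' ∈ D.1,
            s(v, r) ∈ ω ∧ s(v', r') ∈ ω ∧ ω ∈ openConnIn ((↑D.1 : Set (Site d)) \ ↑(box d (σ M₁ - 1))) v v'} ∩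
        {ω : BondConfig (Site d) | ∃ x ∈ X, ∃ r ∈ D.2, ∃ v ∈ D.1, ω ∈ openConnIn ((↑D.1 : Set (Site d)) \ ↑H) x v ∧ s(v, r) ∈ ω} =
      G ∩ ({ω : BondConfig (Site d) | ∃ x ∈ X, ∃ r ∈ D.2, ∃ v ∈ D.1, ω ∈ openConnIn ((↑D.1 : Set (Site d)) \ ↑H) x v ∧ s(v, r) ∈ ω} ∩
        {ω : BondConfig (Site d) | ω ∩ (↑((box d (σ M₂ + 1)).sym2) : Set (Sym2 (Site d))) ∈
            explEvent (↑(box d (σ M₁)) : Set (Site d)) ((↑(box d (σ M₂)) : Set (Site d)) \ ↑(box d (σ M₁))) ↑D.1 ↑D.2} ∩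
        {ω : BondConfig (Site d) | ∀ r ∈ D.2, ∀ r' ∈ D.2, ∃ v ∈ D.1, ∃ v' ∈ D.1,
            s(v, r) ∈ ω ∧ s(v', r') ∈ ω ∧ ω ∈ openConnIn ((↑D.1 : Set (Site d)) \ ↑(box d (σ M₁ - 1))) v v'}) := by
    intro D; ext ω; simp only [Set.mem_inter_iff]; tauto
  simp only [hsum] at h2
  -- the GOOD_in complement inside CONN
  have hGm : MeasurableSet G := hGdet.measurableSet_of_finset
  have hsplit : μ.real CO = μ.real (CO ∩ G) + μ.real (CO \ G) := (measureReal_inter_add_sdiff₀ hGm.nullMeasurableSet).symm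
  have hjunk1 := real_inter_diff_goodIn_le p (c := σ μ₁ - 1) (s := σ μ₂) (by omega) CO
  rw [show σ μ₁ - 1 + 1 = σ μ₁ from by omega] at hjunk1
  have hjunk2 := real_conn_inter_nonuniq_le_of_setToSetQM_aspect p hϰ.le hσ hστ hA2 (m₁ := μ₁) (m₂ := μ₂) (n := n) (by omega)
    hμ12'.le hμ12 (by omega)
    hH hX hXH
  have hCG : μ.real (G ∩ CO) = μ.real (CO ∩ G) := by rw [Set.inter_comm]
  have hϰ2 : 0 < ϰ ^ 2 := by positivity
  have hdiff : μ.real (CO \ G) ≤ ϰ⁻¹ ^ 2 * (μ.real (boxCrossing d (σ μ₁) (σ μ₂)) * μ.real CO) := by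
    rw [inv_pow, le_inv_mul_iff₀ hϰ2]
    exact (mul_le_mul_of_nonneg_left hjunk1 hϰ2.le).trans hjunk2
  constructor
  · have hlow := h2.1
    rw [hCG] at hlow
    have : (1 - ϰ⁻¹ ^ 2 * (μ.real (boxCrossing d (σ μ₁) (σ μ₂)) + μ.real (boxCrossing d (σ M₁) (σ M₂)))) * μ.real CO ≤
        μ.real (CO ∩ G) - ϰ⁻¹ ^ 2 * μ.real (boxCrossing d (σ M₁) (σ M₂)) * μ.real CO := by
      nlinarith [hsplit, hdiff]
    exact this.trans hlow
  · have hup := h2.2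
    rw [hCG] at hup
    exact hup.trans (by linarith [hsplit, measureReal_nonneg (μ := μ) (s := CO \ G)])

/-- **The kernel is within the factor `ϰ` of rank one**: `ϰ · a(H,X) · β(U,R) ≤ M((H,X);(U,R)) ≤ a(H,X) · β(U,R)` with
`a(H,X) = P(X ↔ ∂ⁱⁿΛ(σ m) in Λ(σ m) ∖ H)` and `β(U,R) = Σ_I b(I) · P(IDAT ∩ ILINK ∩ SECOND(U,R;I) ∩ DAT ∩ LINK')` (general aspect; `1 ≤ m`,
`τ m + 2 ≤ σ μ₁`, `τ μ₁ < σ μ₂`, `μ₂ ≤ M₁ ≤ M₂`, `H ⊆ Λ(m−1)`, `X ⊆ Λ(m)`, `X ∩ H = ∅`, `Λ(σ M₁) ⊆ U ⊆ Λ(σ M₂)`, `R ⊆ Λ(σ M₂+1) ∖ Λ(σ M₂)`).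
[cite: Kesten1986, §2 Lemma (23)] [cite: BasuSapozhnikov2017ECP, §2 (2.8)] -/
theorem mul_le_kernel_and_kernel_le_mul_aspect (p : unitInterval) {ϰ : ℝ} (hϰ : 0 ≤ ϰ)
    {σ τ : ℕ → ℕ} (hσ : ∀ m : ℕ, 1 ≤ m → m < σ m) (hστ : ∀ m : ℕ, 1 ≤ m → σ m < τ m) (hσm : Monotone σ)
    (hA2 : ∀ m : ℕ, 1 ≤ m → ∀ Z : Finset (Site d), box d (τ m) \ box d (m - 1) ⊆ Z →
      ∀ X : Finset (Site d), X ⊆ Z ∩ box d m → ∀ Y : Finset (Site d), Y ⊆ Z \ box d (τ m) →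
        ϰ * (bondPercolation (zdGraph d) p).real {ω | ∃ x ∈ X, ∃ s ∈ innerBoundary (zdGraph d) (box d (σ m)),
              ω ∈ openConnIn (↑Z : Set (Site d)) x s} *
          (bondPercolation (zdGraph d) p).real {ω | ∃ y ∈ Y, ∃ s ∈ innerBoundary (zdGraph d) (box d (σ m)),
              ω ∈ openConnIn (↑Z : Set (Site d)) y s} ≤
        (bondPercolation (zdGraph d) p).real {ω | ∃ x ∈ X, ∃ y ∈ Y, ω ∈ openConnIn (↑Z : Set (Site d)) x y})
    {m μ₁ μ₂ M₁ M₂ : ℕ} (hm : 1 ≤ m) (hmμ : τ m + 2 ≤ σ μ₁) (hμ12 : τ μ₁ < σ μ₂) (hμM : μ₂ ≤ M₁) (hM : M₁ ≤ M₂)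
    {H X U R : Finset (Site d)} (hH : H ⊆ box d (m - 1)) (hX : X ⊆ box d m) (hXH : ∀ x ∈ X, x ∉ H)
    (hUa : box d (σ M₁) ⊆ U) (hUb : U ⊆ box d (σ M₂)) (hR : R ⊆ box d (σ M₂ + 1)) (hRb : ∀ r ∈ R, r ∉ box d (σ M₂)) :
    ϰ * (bondPercolation (zdGraph d) p).real {ω : BondConfig (Site d) | ∃ x ∈ X, ∃ w ∈ innerBoundary (zdGraph d) (box d (σ m)),
          ω ∈ openConnIn ((↑(box d (σ m)) : Set (Site d)) \ ↑H) x w} *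
      (∑ I ∈ (box d (σ μ₂ - 1) \ box d (σ μ₁ - 1)).powerset ×ˢ (innerBoundary (zdGraph d) (box d (σ μ₁ - 1))).powerset,
        (bondPercolation (zdGraph d) p).real {ω : BondConfig (Site d) | ∃ y ∈ I.2, ∃ w ∈ innerBoundary (zdGraph d) (box d (σ m)),
          ω ∈ openConnIn ((↑(box d (σ μ₂)) : Set (Site d)) \ (↑(I.1 ∪ innerBoundary (zdGraph d) (box d (σ μ₂))) ∪ ↑(box d (σ m - 1)))) y w} *
        (bondPercolation (zdGraph d) p).real
          ({ω : BondConfig (Site d) | ω ∩ (↑((box d (σ μ₂)).sym2) : Set (Sym2 (Site d))) ∈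
                explEvent ((↑(box d (σ μ₂ - 1)) : Set (Site d))ᶜ) ((↑(box d (σ μ₂ - 1)) : Set (Site d)) \ ↑(box d (σ μ₁ - 1)))
                  ((↑(box d (σ μ₂ - 1)) : Set (Site d))ᶜ ∪ ↑I.1) ↑I.2} ∩
           {ω : BondConfig (Site d) | ∀ y ∈ I.2, ∀ y' ∈ I.2, ∀ z ∈ I.1 ∪ innerBoundary (zdGraph d) (box d (σ μ₂)),
                ∀ z' ∈ I.1 ∪ innerBoundary (zdGraph d) (box d (σ μ₂)), s(z, y) ∈ ω → s(z', y') ∈ ω →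
                ω ∈ openConnIn (↑(I.1 ∪ innerBoundary (zdGraph d) (box d (σ μ₂))) : Set (Site d)) z z'} ∩
           {ω : BondConfig (Site d) | ∃ y ∈ I.2, ∃ z ∈ I.1 ∪ innerBoundary (zdGraph d) (box d (σ μ₂)), s(z, y) ∈ ω ∧
            ∃ r ∈ R, ∃ v ∈ U, ω ∈ openConnIn ((↑(I.1 ∪ innerBoundary (zdGraph d) (box d (σ μ₂))) : Set (Site d)) ∪ (↑U \ ↑(box d (σ μ₂)))) z v ∧
              s(v, r) ∈ ω} ∩
           {ω : BondConfig (Site d) | ω ∩ (↑((box d (σ M₂ + 1)).sym2) : Set (Sym2 (Site d))) ∈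
            explEvent (↑(box d (σ M₁)) : Set (Site d)) ((↑(box d (σ M₂)) : Set (Site d)) \ ↑(box d (σ M₁))) ↑U ↑R} ∩
           {ω : BondConfig (Site d) | ∀ r ∈ R, ∀ r' ∈ R, ∃ v ∈ U, ∃ v' ∈ U,
            s(v, r) ∈ ω ∧ s(v', r') ∈ ω ∧ ω ∈ openConnIn ((↑U : Set (Site d)) \ ↑(box d (σ M₁ - 1))) v v'})) ≤
      (bondPercolation (zdGraph d) p).real
        ((⋃ I ∈ (box d (σ μ₂ - 1) \ box d (σ μ₁ - 1)).powerset ×ˢ (innerBoundary (zdGraph d) (box d (σ μ₁ - 1))).powerset,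
            ({ω : BondConfig (Site d) | ω ∩ (↑((box d (σ μ₂)).sym2) : Set (Sym2 (Site d))) ∈
                explEvent ((↑(box d (σ μ₂ - 1)) : Set (Site d))ᶜ) ((↑(box d (σ μ₂ - 1)) : Set (Site d)) \ ↑(box d (σ μ₁ - 1)))
                  ((↑(box d (σ μ₂ - 1)) : Set (Site d))ᶜ ∪ ↑I.1) ↑I.2} ∩
             {ω : BondConfig (Site d) | ∀ y ∈ I.2, ∀ y' ∈ I.2, ∀ z ∈ I.1 ∪ innerBoundary (zdGraph d) (box d (σ μ₂)),
                ∀ z' ∈ I.1 ∪ innerBoundary (zdGraph d) (box d (σ μ₂)), s(z, y) ∈ ω → s(z', y') ∈ ω →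
                ω ∈ openConnIn (↑(I.1 ∪ innerBoundary (zdGraph d) (box d (σ μ₂))) : Set (Site d)) z z'})) ∩
          ({ω : BondConfig (Site d) | ∃ x ∈ X, ∃ r ∈ R, ∃ v ∈ U, ω ∈ openConnIn ((↑U : Set (Site d)) \ ↑H) x v ∧ s(v, r) ∈ ω} ∩
           {ω : BondConfig (Site d) | ω ∩ (↑((box d (σ M₂ + 1)).sym2) : Set (Sym2 (Site d))) ∈
            explEvent (↑(box d (σ M₁)) : Set (Site d)) ((↑(box d (σ M₂)) : Set (Site d)) \ ↑(box d (σ M₁))) ↑U ↑R} ∩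
           {ω : BondConfig (Site d) | ∀ r ∈ R, ∀ r' ∈ R, ∃ v ∈ U, ∃ v' ∈ U,
            s(v, r) ∈ ω ∧ s(v', r') ∈ ω ∧ ω ∈ openConnIn ((↑U : Set (Site d)) \ ↑(box d (σ M₁ - 1))) v v'})) ∧
    (bondPercolation (zdGraph d) p).real
        ((⋃ I ∈ (box d (σ μ₂ - 1) \ box d (σ μ₁ - 1)).powerset ×ˢ (innerBoundary (zdGraph d) (box d (σ μ₁ - 1))).powerset,
            ({ω : BondConfig (Site d) | ω ∩ (↑((box d (σ μ₂)).sym2) : Set (Sym2 (Site d))) ∈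
                explEvent ((↑(box d (σ μ₂ - 1)) : Set (Site d))ᶜ) ((↑(box d (σ μ₂ - 1)) : Set (Site d)) \ ↑(box d (σ μ₁ - 1)))
                  ((↑(box d (σ μ₂ - 1)) : Set (Site d))ᶜ ∪ ↑I.1) ↑I.2} ∩
             {ω : BondConfig (Site d) | ∀ y ∈ I.2, ∀ y' ∈ I.2, ∀ z ∈ I.1 ∪ innerBoundary (zdGraph d) (box d (σ μ₂)),
                ∀ z' ∈ I.1 ∪ innerBoundary (zdGraph d) (box d (σ μ₂)), s(z, y) ∈ ω → s(z', y') ∈ ω →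
                ω ∈ openConnIn (↑(I.1 ∪ innerBoundary (zdGraph d) (box d (σ μ₂))) : Set (Site d)) z z'})) ∩
          ({ω : BondConfig (Site d) | ∃ x ∈ X, ∃ r ∈ R, ∃ v ∈ U, ω ∈ openConnIn ((↑U : Set (Site d)) \ ↑H) x v ∧ s(v, r) ∈ ω} ∩
           {ω : BondConfig (Site d) | ω ∩ (↑((box d (σ M₂ + 1)).sym2) : Set (Sym2 (Site d))) ∈
            explEvent (↑(box d (σ M₁)) : Set (Site d)) ((↑(box d (σ M₂)) : Set (Site d)) \ ↑(box d (σ M₁))) ↑U ↑R} ∩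
           {ω : BondConfig (Site d) | ∀ r ∈ R, ∀ r' ∈ R, ∃ v ∈ U, ∃ v' ∈ U,
            s(v, r) ∈ ω ∧ s(v', r') ∈ ω ∧ ω ∈ openConnIn ((↑U : Set (Site d)) \ ↑(box d (σ M₁ - 1))) v v'})) ≤
      (bondPercolation (zdGraph d) p).real {ω : BondConfig (Site d) | ∃ x ∈ X, ∃ w ∈ innerBoundary (zdGraph d) (box d (σ m)),
          ω ∈ openConnIn ((↑(box d (σ m)) : Set (Site d)) \ ↑H) x w} *
      (∑ I ∈ (box d (σ μ₂ - 1) \ box d (σ μ₁ - 1)).powerset ×ˢ (innerBoundary (zdGraph d) (box d (σ μ₁ - 1))).powerset,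
        (bondPercolation (zdGraph d) p).real {ω : BondConfig (Site d) | ∃ y ∈ I.2, ∃ w ∈ innerBoundary (zdGraph d) (box d (σ m)),
          ω ∈ openConnIn ((↑(box d (σ μ₂)) : Set (Site d)) \ (↑(I.1 ∪ innerBoundary (zdGraph d) (box d (σ μ₂))) ∪ ↑(box d (σ m - 1)))) y w} *
        (bondPercolation (zdGraph d) p).real
          ({ω : BondConfig (Site d) | ω ∩ (↑((box d (σ μ₂)).sym2) : Set (Sym2 (Site d))) ∈
                explEvent ((↑(box d (σ μ₂ - 1)) : Set (Site d))ᶜ) ((↑(box d (σ μ₂ - 1)) : Set (Site d)) \ ↑(box d (σ μ₁ - 1)))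
                  ((↑(box d (σ μ₂ - 1)) : Set (Site d))ᶜ ∪ ↑I.1) ↑I.2} ∩
           {ω : BondConfig (Site d) | ∀ y ∈ I.2, ∀ y' ∈ I.2, ∀ z ∈ I.1 ∪ innerBoundary (zdGraph d) (box d (σ μ₂)),
                ∀ z' ∈ I.1 ∪ innerBoundary (zdGraph d) (box d (σ μ₂)), s(z, y) ∈ ω → s(z', y') ∈ ω →
                ω ∈ openConnIn (↑(I.1 ∪ innerBoundary (zdGraph d) (box d (σ μ₂))) : Set (Site d)) z z'} ∩
           {ω : BondConfig (Site d) | ∃ y ∈ I.2, ∃ z ∈ I.1 ∪ innerBoundary (zdGraph d) (box d (σ μ₂)), s(z, y) ∈ ω ∧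
            ∃ r ∈ R, ∃ v ∈ U, ω ∈ openConnIn ((↑(I.1 ∪ innerBoundary (zdGraph d) (box d (σ μ₂))) : Set (Site d)) ∪ (↑U \ ↑(box d (σ μ₂)))) z v ∧
              s(v, r) ∈ ω} ∩
           {ω : BondConfig (Site d) | ω ∩ (↑((box d (σ M₂ + 1)).sym2) : Set (Sym2 (Site d))) ∈
            explEvent (↑(box d (σ M₁)) : Set (Site d)) ((↑(box d (σ M₂)) : Set (Site d)) \ ↑(box d (σ M₁))) ↑U ↑R} ∩
           {ω : BondConfig (Site d) | ∀ r ∈ R, ∀ r' ∈ R, ∃ v ∈ U, ∃ v' ∈ U,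
            s(v, r) ∈ ω ∧ s(v', r') ∈ ω ∧ ω ∈ openConnIn ((↑U : Set (Site d)) \ ↑(box d (σ M₁ - 1))) v v'})) := by
  classical
  have hσ0 := hσ m hm
  have hστ0 := hστ m hm
  have hmμ' : m < μ₁ := hσm.reflect_lt (by omega)
  have hσ1 := hσ μ₁ (by omega)
  have hστ1 := hστ μ₁ (by omega)
  have hc : 1 ≤ σ μ₁ - 1 := by omega
  have hcs : σ μ₁ - 1 + 2 ≤ σ μ₂ := by omega
  have hHc : H ⊆ box d (σ μ₁ - 1 - 1) := hH.trans (box_mono d (by omega))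
  have hXc : X ⊆ box d (σ μ₁ - 1 - 1) := hX.trans (box_mono d (by omega))
  rw [← sum_real_kernel_eq p hc hcs (hσm hμM) (hσm hM) hHc hXc hUa hUb hR hRb,
    Finset.mul_sum, Finset.mul_sum]
  constructor
  · refine Finset.sum_le_sum fun I hI => ?_
    rw [Finset.mem_product, Finset.mem_powerset, Finset.mem_powerset] at hI
    have h := mul_le_real_first_aspect p hϰ hσ hστ hA2 hm (by omega : τ m ≤ σ μ₁ - 1 - 1) (by omega : σ μ₁ - 1 < σ μ₂)
      hH hX hXH hI.1 hI.2
    calc _ = (ϰ * (bondPercolation (zdGraph d) p).real {ω : BondConfig (Site d) | ∃ x ∈ X, ∃ w ∈ innerBoundary (zdGraph d) (box d (σ m)),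
          ω ∈ openConnIn ((↑(box d (σ m)) : Set (Site d)) \ ↑H) x w} *
          (bondPercolation (zdGraph d) p).real {ω : BondConfig (Site d) | ∃ y ∈ I.2, ∃ w ∈ innerBoundary (zdGraph d) (box d (σ m)),
          ω ∈ openConnIn ((↑(box d (σ μ₂)) : Set (Site d)) \ (↑(I.1 ∪ innerBoundary (zdGraph d) (box d (σ μ₂))) ∪ ↑(box d (σ m - 1)))) y w}) *
          (bondPercolation (zdGraph d) p).real
            ({ω : BondConfig (Site d) | ω ∩ (↑((box d (σ μ₂)).sym2) : Set (Sym2 (Site d))) ∈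
                explEvent ((↑(box d (σ μ₂ - 1)) : Set (Site d))ᶜ) ((↑(box d (σ μ₂ - 1)) : Set (Site d)) \ ↑(box d (σ μ₁ - 1)))
                  ((↑(box d (σ μ₂ - 1)) : Set (Site d))ᶜ ∪ ↑I.1) ↑I.2} ∩
           {ω : BondConfig (Site d) | ∀ y ∈ I.2, ∀ y' ∈ I.2, ∀ z ∈ I.1 ∪ innerBoundary (zdGraph d) (box d (σ μ₂)),
                ∀ z' ∈ I.1 ∪ innerBoundary (zdGraph d) (box d (σ μ₂)), s(z, y) ∈ ω → s(z', y') ∈ ω →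
                ω ∈ openConnIn (↑(I.1 ∪ innerBoundary (zdGraph d) (box d (σ μ₂))) : Set (Site d)) z z'} ∩
           {ω : BondConfig (Site d) | ∃ y ∈ I.2, ∃ z ∈ I.1 ∪ innerBoundary (zdGraph d) (box d (σ μ₂)), s(z, y) ∈ ω ∧
            ∃ r ∈ R, ∃ v ∈ U, ω ∈ openConnIn ((↑(I.1 ∪ innerBoundary (zdGraph d) (box d (σ μ₂))) : Set (Site d)) ∪ (↑U \ ↑(box d (σ μ₂)))) z v ∧
              s(v, r) ∈ ω} ∩
           {ω : BondConfig (Site d) | ω ∩ (↑((box d (σ M₂ + 1)).sym2) : Set (Sym2 (Site d))) ∈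
            explEvent (↑(box d (σ M₁)) : Set (Site d)) ((↑(box d (σ M₂)) : Set (Site d)) \ ↑(box d (σ M₁))) ↑U ↑R} ∩
           {ω : BondConfig (Site d) | ∀ r ∈ R, ∀ r' ∈ R, ∃ v ∈ U, ∃ v' ∈ U,
            s(v, r) ∈ ω ∧ s(v', r') ∈ ω ∧ ω ∈ openConnIn ((↑U : Set (Site d)) \ ↑(box d (σ M₁ - 1))) v v'}) := by ring
      _ ≤ _ := mul_le_mul_of_nonneg_right h measureReal_nonneg
  · refine Finset.sum_le_sum fun I hI => ?_
    rw [Finset.mem_product, Finset.mem_powerset, Finset.mem_powerset] at hI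
    have h := real_first_le_mul_aspect p hσ (σ μ₂) hm (by omega : σ m ≤ σ μ₁ - 1) (H := H) (Xs := I.1) hX hI.2
    calc _ ≤ ((bondPercolation (zdGraph d) p).real {ω : BondConfig (Site d) | ∃ x ∈ X, ∃ w ∈ innerBoundary (zdGraph d) (box d (σ m)),
          ω ∈ openConnIn ((↑(box d (σ m)) : Set (Site d)) \ ↑H) x w} *
          (bondPercolation (zdGraph d) p).real {ω : BondConfig (Site d) | ∃ y ∈ I.2, ∃ w ∈ innerBoundary (zdGraph d) (box d (σ m)),
          ω ∈ openConnIn ((↑(box d (σ μ₂)) : Set (Site d)) \ (↑(I.1 ∪ innerBoundary (zdGraph d) (box d (σ μ₂))) ∪ ↑(box d (σ m - 1)))) y w}) *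
          (bondPercolation (zdGraph d) p).real
            ({ω : BondConfig (Site d) | ω ∩ (↑((box d (σ μ₂)).sym2) : Set (Sym2 (Site d))) ∈
                explEvent ((↑(box d (σ μ₂ - 1)) : Set (Site d))ᶜ) ((↑(box d (σ μ₂ - 1)) : Set (Site d)) \ ↑(box d (σ μ₁ - 1)))
                  ((↑(box d (σ μ₂ - 1)) : Set (Site d))ᶜ ∪ ↑I.1) ↑I.2} ∩
           {ω : BondConfig (Site d) | ∀ y ∈ I.2, ∀ y' ∈ I.2, ∀ z ∈ I.1 ∪ innerBoundary (zdGraph d) (box d (σ μ₂)),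
                ∀ z' ∈ I.1 ∪ innerBoundary (zdGraph d) (box d (σ μ₂)), s(z, y) ∈ ω → s(z', y') ∈ ω →
                ω ∈ openConnIn (↑(I.1 ∪ innerBoundary (zdGraph d) (box d (σ μ₂))) : Set (Site d)) z z'} ∩
           {ω : BondConfig (Site d) | ∃ y ∈ I.2, ∃ z ∈ I.1 ∪ innerBoundary (zdGraph d) (box d (σ μ₂)), s(z, y) ∈ ω ∧
            ∃ r ∈ R, ∃ v ∈ U, ω ∈ openConnIn ((↑(I.1 ∪ innerBoundary (zdGraph d) (box d (σ μ₂))) : Set (Site d)) ∪ (↑U \ ↑(box d (σ μ₂)))) z v ∧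
              s(v, r) ∈ ω} ∩
           {ω : BondConfig (Site d) | ω ∩ (↑((box d (σ M₂ + 1)).sym2) : Set (Sym2 (Site d))) ∈
            explEvent (↑(box d (σ M₁)) : Set (Site d)) ((↑(box d (σ M₂)) : Set (Site d)) \ ↑(box d (σ M₁))) ↑U ↑R} ∩
           {ω : BondConfig (Site d) | ∀ r ∈ R, ∀ r' ∈ R, ∃ v ∈ U, ∃ v' ∈ U,
            s(v, r) ∈ ω ∧ s(v', r') ∈ ω ∧ ω ∈ openConnIn ((↑U : Set (Site d)) \ ↑(box d (σ M₁ - 1))) v v'}) := mul_le_mul_of_nonneg_right h measureReal_nonneg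
      _ = _ := by ring

end Summit.CriticalPhenomena.PercolationContinuityZ3.Theorems.Crossing

end
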